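import Summits.Langlands.Langlands.Theorems.IrreducibilityBySelfDualityReciprocityUpToIrreducibilityGeometricConstituents
import HarnessLib

/-!
# Irreducible constituents of a framed Galois representation (plain form, no geometric hypothesis)
(crux stmt-Langlands-14329 `IrreducibilityBySelfDuality.IrreducibleOffSector`, line `Sketch`;
`--supports` file, lead c8 CONSTITUENT package)

Let `K` be any field, `ℓ` a prime and `ρ : Γ_K →ₜ* GL_n(ℚ̄_ℓ)` (`n ≥ 1`) ANY continuous framed
representation of the absolute Galois group of `K` (no number-field, unramifiedness or de Rham
hypothesis).  Then `ρ` has finitely many IRREDUCIBLE framed constituents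
`r i : Γ_K →ₜ* GL_{m_i}(ℚ̄_ℓ)` (`0 < k` of them, every `m_i ≥ 1`) with
`det(X - ρ(g)) = ∏ᵢ det(X - r_i(g))` for every `g`, with `r_i(g) = 1` wherever `ρ(g) = 1` (so
unramifiedness at a place — triviality on inertia — is inherited by every constituent), and with `ρ`
irreducible when `k = 1` (`exists_irreducible_constituents`).  This is the Jordan–Hölder dévissage
of the tree theorem `ReciprocityUpToIrreducibility.exists_geometricConstituents` with the geometric
bookkeeping deleted: strong induction on `n`; if `ρ` is reducible, `ℚ̄_ℓⁿ` has a proper non-zero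
stable subspace (this uses `0 < n`), the continuous dévissage with the change of frame recorded
(`ReciprocityUpToIrreducibility.exists_conj_continuous_blocks_galois`) makes `P ρ P⁻¹` block upper
triangular with continuous diagonal blocks `A`, `D` of smaller positive ranks, whence
`det(X - ρ g) = det(X - A g) · det(X - D g)` (`charpoly_conj_eq`,
`charpoly_eq_mul_of_blockTriangular`) and `ρ g = 1 ⇒ A g = 1 ∧ D g = 1` (`conj_apply_eq_one`,
`eq_one_of_blockTriangular`); recurse on `A`, `D` and concatenate the two families
(`Fin.addCases`, `Fin.prod_univ_add`).  The lead combines it with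
`exists_block_not_weaklyAutomorphic_of_rational` to extract, from a REDUCIBLE compatible avatar,
an irreducible constituent of rank `2 … n - 1` that is not weakly automorphic.

References: N. Bourbaki, *Algèbre* VIII (2012), § 20 n° 6 (Jordan–Hölder constituents and
characteristic polynomials); C. W. Curtis, I. Reiner, *Methods of Representation Theory* I (1981),
§16B — folklore.
-/

noncomputable section

set_option linter.dupNamespace false

open scoped NumberField Classical
open Filter IsDedekindDomain NumberField
open Literature.NumberTheory.Automorphic Literature.NumberTheory.GaloisRepresentations

namespace Summit.Langlands.Langlands.Theorems.IrreducibleOffSector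

/-- **Irreducible constituents of a framed Galois representation (with `0 < k`), by strong
induction on the rank.**  If `ρ` is irreducible take `k = 1`, `r 0 = ρ`.  Otherwise `ℚ̄_ℓⁿ` has a
proper non-zero stable subspace; the continuous dévissage with the change of frame recorded gives
`P ρ P⁻¹` block upper triangular with continuous diagonal blocks `A`, `D` of smaller positive
ranks, with `det(X - ρ g) = det(X - A g) det(X - D g)` and `A g = D g = 1` wherever `ρ g = 1`;
recurse on `A`, `D` and concatenate.  Bourbaki, *Algèbre* VIII § 20 n° 6; Curtis–Reiner,
*Methods* I §16B. [folklore] -/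
theorem exists_irreducible_constituents {K : Type} [Field K] {ℓ : ℕ} [Fact ℓ.Prime] {n : ℕ}
    (ρ : FramedGaloisRep K (PadicAlgCl ℓ) n) (hn : 0 < n) :
    ∃ (k : ℕ) (m : Fin k → ℕ) (r : ∀ i, FramedGaloisRep K (PadicAlgCl ℓ) (m i)), 0 < k ∧
      (∀ i, 0 < m i ∧ (r i).toGaloisRep.IsIrreducible) ∧
      (∀ g, ρ.charpoly g = ∏ i, (r i).charpoly g) ∧
      (∀ g, ρ g = 1 → ∀ i, r i g = 1) ∧
      (k = 1 → ρ.toGaloisRep.IsIrreducible) := by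
  induction n using Nat.strong_induction_on with
  | _ n ih =>
    by_cases hirr : ρ.toGaloisRep.IsIrreducible
    · refine ⟨1, fun _ ↦ n, fun _ ↦ ρ, one_pos, fun _ ↦ ⟨hn, hirr⟩, fun g ↦ ?_,
        fun g hg _ ↦ hg, fun _ ↦ hirr⟩
      rw [Fin.prod_univ_one]
    -- a proper non-zero stable subspace of `ℚ̄_ℓⁿ`
    have hirr' : ¬ IsSimpleOrder (Subrepresentation (FramedRep.toRepresentation ρ)) := hirr
    have hW : ∃ W : Subrepresentation (FramedRep.toRepresentation ρ), W ≠ ⊥ ∧ W ≠ ⊤ := by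
      by_contra hcon
      push Not at hcon
      have hbt : (⊥ : Subrepresentation (FramedRep.toRepresentation ρ)) ≠ ⊤ := by
        intro h
        have h' := congrArg Subrepresentation.toSubmodule h
        change (⊥ : Submodule (PadicAlgCl ℓ) (Fin n → PadicAlgCl ℓ)) = ⊤ at h'
        haveI : Nonempty (Fin n) := ⟨⟨0, hn⟩⟩
        exact bot_ne_top h'
      haveI : Nontrivial (Subrepresentation (FramedRep.toRepresentation ρ)) := ⟨⟨⊥, ⊤, hbt⟩⟩
      exact hirr' ⟨fun W ↦ or_iff_not_imp_left.mpr (hcon W)⟩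
    obtain ⟨W, hW0, hW1⟩ := hW
    -- continuous dévissage with the change of frame recorded
    obtain ⟨m, p, hm0, hp0, hmn, hpn, e, P, A, D, hT⟩ :=
      ReciprocityUpToIrreducibility.exists_conj_continuous_blocks_galois K ℓ n ρ W hW0 hW1
    have hcp : ∀ g, ρ.charpoly g = FramedRep.charpoly A g * FramedRep.charpoly D g := fun g ↦ by
      rw [← ReciprocityUpToIrreducibility.charpoly_conj_eq P ρ g]
      exact ReciprocityUpToIrreducibility.charpoly_eq_mul_of_blockTriangular e _ A D hT g
    have hone : ∀ g, ρ g = 1 → A g = 1 ∧ D g = 1 := fun g hg ↦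
      ReciprocityUpToIrreducibility.eq_one_of_blockTriangular e _ A D hT
        (ReciprocityUpToIrreducibility.conj_apply_eq_one P ρ hg)
    -- recurse on the two diagonal blocks (of smaller positive rank)
    obtain ⟨k₁, m₁, r₁, hk₁, hr₁, hcp₁, hone₁, -⟩ := ih m hmn A hm0
    obtain ⟨k₂, m₂, r₂, hk₂, hr₂, hcp₂, hone₂, -⟩ := ih p hpn D hp0
    -- concatenate the two families (as one family of dependent pairs `⟨m i, r i⟩`)
    let mr : Fin (k₁ + k₂) → (Σ d : ℕ, FramedGaloisRep K (PadicAlgCl ℓ) d) :=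
      Fin.addCases (fun i ↦ ⟨m₁ i, r₁ i⟩) (fun i ↦ ⟨m₂ i, r₂ i⟩)
    have hmr₁ : ∀ i, mr (Fin.castAdd k₂ i) = ⟨m₁ i, r₁ i⟩ := fun i ↦ Fin.addCases_left i
    have hmr₂ : ∀ i, mr (Fin.natAdd k₁ i) = ⟨m₂ i, r₂ i⟩ := fun i ↦ Fin.addCases_right i
    have hQ : ∀ i, 0 < (mr i).1 ∧ (mr i).2.toGaloisRep.IsIrreducible := by
      intro i
      refine Fin.addCases (fun i ↦ ?_) (fun i ↦ ?_) i
      · rw [hmr₁]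
        exact hr₁ i
      · rw [hmr₂]
        exact hr₂ i
    have hprod : ∀ g : Field.absoluteGaloisGroup K, ρ.charpoly g = ∏ i, (mr i).2.charpoly g := by
      intro g
      rw [hcp g, Fin.prod_univ_add, hcp₁ g, hcp₂ g]
      congr 1
      · exact Finset.prod_congr rfl fun i _ ↦ by rw [hmr₁]
      · exact Finset.prod_congr rfl fun i _ ↦ by rw [hmr₂]
    have hU : ∀ g : Field.absoluteGaloisGroup K, ρ g = 1 → ∀ i, (mr i).2 g = 1 := by
      intro g hg i
      refine Fin.addCases (fun i ↦ ?_) (fun i ↦ ?_) i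
      · rw [hmr₁]
        exact hone₁ g (hone g hg).1 i
      · rw [hmr₂]
        exact hone₂ g (hone g hg).2 i
    exact ⟨k₁ + k₂, fun i ↦ (mr i).1, fun i ↦ (mr i).2, by omega, hQ, hprod, hU,
      fun h ↦ absurd h (by omega)⟩

end Summit.Langlands.Langlands.Theorems.IrreducibleOffSector

end
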